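import Literature.Algebra.Homology.LaurentCechEval
import Literature.Algebra.Homology.SerreFinitenessH0
import Literature.Algebra.Homology.SerreVanishing
import Literature.Algebra.Homology.OrderedCechPieces
import HarnessLib

/-!
# The evaluated Čech complexes `Č_d(𝕜; θ, σ)` and Serre's theorems for them

Let `A` be a commutative ring, `𝕜` a commutative `A`-algebra, `θ₀, …, θ_M ∈ 𝕜ˣ` and `σ : J → 𝕜`
(`J` finite, shift `e : J → ℤ`), as in `Literature/Algebra/Homology/LaurentCechEval` (in the
application `𝕜 = K(Z)` for an integral closed `Z ⊆ 𝐏^M_{A'}` over some ring `A'` mapping to `A`,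
`θ_c = x_c/x_{c₀}`, `J = pt`, `σ = 1`). The evaluation `evalVec θ σ : L^J → 𝕜` carries the degree-`d`
localized pieces `((L^J)_{x_s})_d` (`LaurentCech.locDeg e ⊤ s d`) onto `A`-submodules
`LaurentCech.evFam A θ σ e d s ⊆ 𝕜` — the `A`-span of the "sections" `σ_j θ^m`, `deg m = d - e_j`,
with poles along `s` only; for `Z ⊆ 𝐏^M` these are the sections `Γ(Z_s, 𝒪_Z(d))` read in `K(Z)`
through the trivialisation at `x_{c₀}` — a monotone family whose ordered Čech complex
`LaurentCech.evCplx A θ σ e d` sits in the SHORT EXACT SEQUENCE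

  `0 → Č_d(K) → Č_d(L^J) → evCplx A θ σ e d → 0`,  `K = kerGraded e θ σ`

(`LaurentCech.evSes`, `LaurentCech.shortExact_evSes`; exactness in the middle is
`mem_locDeg_kerGraded_of_evalVec_eq_zero` of `LaurentCechEval`). Since `K` is graded
(`isGraded_kerGraded`), the tree's algebraic Serre theorems apply verbatim:

* `LaurentCech.moduleFinite_homology_evCplx` — for `A` Noetherian, ALL `H^i(evCplx A θ σ e d)` are
  finitely generated `A`-modules (`SerreFinitenessH0.moduleFinite_homology_of_shortExact_all`;
  Hartshorne III Thm. 5.2 (a));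
* `LaurentCech.exists_forall_isZero_homology_evCplx` — for `A` Noetherian there is `d₀` with
  `H^i(evCplx A θ σ e d) = 0` for all `d ≥ d₀`, `i ≥ 1`
  (`SerreVanishing.exists_forall_isZero_homology_of_shortExact`; Hartshorne III Thm. 5.2 (b)).

Pure algebra; everything is proved, no named facts. This is the form of Serre's theorems consumed by
the finiteness theorem for proper morphisms via Chow's lemma (Görtz–Wedhorn II, Thm. 23.17: the
same `θ` serve every base ring `A' → Γ(U, 𝒪_V) → K(V')`, so that ONE construction gives Serre's
theorem over `A` and, over the rings of the affine opens `U ⊆ V`, the relative vanishing along the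
Chow cover).

## References

* R. Hartshorne, *Algebraic Geometry*, GTM 52 (1977): III Thm. 5.2 (a), (b) and proof, p. 228.
  [Hartshorne1977]
* J.-P. Serre, *Faisceaux algébriques cohérents*, Ann. of Math. 61 (1955), n° 66.
* U. Görtz, T. Wedhorn, *Algebraic Geometry II* (2023), Thm. 23.1, Thm. 23.17 (pp. 412, 424).
  [GortzWedhorn2023]
-/

noncomputable section

open CategoryTheory CategoryTheory.Limits

universe u

namespace Literature.Algebra.Homology

namespace LaurentCech

open OrderedCech

variable (A : Type u) [CommRing A] {M : ℕ} {𝕜 : Type u} [CommRing 𝕜] [Algebra A 𝕜]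
variable (θ : Fin (M + 1) → 𝕜) (hθ : ∀ c, IsUnit (θ c)) {J : Type} [Fintype J] (σ : J → 𝕜)
  (e : J → ℤ)

/-! ### The evaluated family and its Čech complex -/

/-- **The evaluated family** `s ↦ evalVec ((L^J_{x_s})_d) ⊆ 𝕜`: the `A`-span of the `σ_j θ^m`,
`deg m + e_j = d`, `m_c < 0` only for `c ∈ s` (for `Z ⊆ 𝐏^M`: `Γ(Z_s, 𝒪_Z(d))` in `K(Z)`).
[folklore] -/
def evFam (d : ℤ) (s : Finset (Fin (M + 1))) : Submodule A 𝕜 :=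
  Submodule.map (evalVec (A := A) θ hθ σ) (locDeg e (⊤ : Submodule (P A M) (J → P A M)) s d)

/-- Membership in the evaluated family. [folklore] -/
theorem mem_evFam {d : ℤ} {s : Finset (Fin (M + 1))} {y : 𝕜} :
    y ∈ evFam A θ hθ σ e d s ↔
      ∃ v ∈ locDeg e (⊤ : Submodule (P A M) (J → P A M)) s d, evalVec (A := A) θ hθ σ v = y :=
  Submodule.mem_map

/-- The evaluated family is monotone. [folklore] -/
theorem evFam_mono (d : ℤ) : Monotone (evFam A θ hθ σ e d) := fun _ _ hst =>
  Submodule.map_mono (locDeg_mono e _ d hst)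

/-- **The evaluated Čech complex `Č_d(𝕜; θ, σ)`**: the ordered Čech complex of the evaluated
family. [folklore] -/
abbrev evCplx (d : ℤ) : CochainComplex (ModuleCat.{u} A) ℤ :=
  complex (evFam A θ hθ σ e d) (evFam_mono A θ hθ σ e d)

/-- The memberwise evaluation maps `((L^J)_{x_s})_d → evFam d s`. [folklore] -/
def evMap (d : ℤ) (s : Finset (Fin (M + 1))) :
    locDeg e (⊤ : Submodule (P A M) (J → P A M)) s d →ₗ[A] evFam A θ hθ σ e d s :=
  (evalVec (A := A) θ hθ σ).restrict fun _ hx => Submodule.mem_map_of_mem hx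

/-- The value of `evMap`. [folklore] -/
@[simp] theorem coe_evMap {d : ℤ} {s : Finset (Fin (M + 1))}
    (x : locDeg e (⊤ : Submodule (P A M) (J → P A M)) s d) :
    ((evMap A θ hθ σ e d s x : evFam A θ hθ σ e d s) : 𝕜) = evalVec (A := A) θ hθ σ x := rfl

/-- The `evMap` are surjective. [folklore] -/
theorem evMap_surjective (d : ℤ) (s : Finset (Fin (M + 1))) :
    Function.Surjective (evMap A θ hθ σ e d s) := by
  rintro ⟨y, hy⟩
  obtain ⟨v, hv, rfl⟩ := (mem_evFam A θ hθ σ e).1 hy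
  exact ⟨⟨v, hv⟩, Subtype.ext rfl⟩

/-! ### The short exact sequence -/

variable {A} in
omit [Fintype J] in
/-- The inclusion `Č_d(K) ⊆ Č_d(L^J)` in the form consumed by `complexMap`. [folklore] -/
theorem id_mem_locDeg_top (K : Submodule (P A M) (J → P A M)) (d : ℤ) :
    ∀ s, ∀ x ∈ locDeg e K s d, LinearMap.id (R := A) x ∈
      locDeg e (⊤ : Submodule (P A M) (J → P A M)) s d :=
  fun s _ hx => ⟨loc_mono_left le_top s hx.1, hx.2⟩

/-- The Čech family `s ↦ (K_{x_s})_d` of the graded kernel `K = kerGraded e θ σ`. [folklore] -/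
abbrev famK (d : ℤ) (s : Finset (Fin (M + 1))) : Submodule A (J → L A M) :=
  locDeg e (kerGraded A M e θ hθ σ) s d

/-- The Čech family `s ↦ ((L^J)_{x_s})_d` of the free module. [folklore] -/
abbrev famT (d : ℤ) (s : Finset (Fin (M + 1))) : Submodule A (J → L A M) :=
  locDeg e (⊤ : Submodule (P A M) (J → P A M)) s d

/-- `evMap` kills the members of the graded kernel. [folklore] -/
theorem evMap_eq_zero_of_mem {d : ℤ} {s : Finset (Fin (M + 1))} (x : famT A e d s)
    (hx : (x : J → L A M) ∈ famK A θ hθ σ e d s) : evMap A θ hθ σ e d s x = 0 :=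
  Subtype.ext (evalVec_eq_zero_of_mem_locDeg_kerGraded e θ hθ σ hx)

/-- Conversely, the kernel of `evMap` on `((L^J)_{x_s})_d` is `(K_{x_s})_d`. [folklore] -/
theorem mem_of_evMap_eq_zero {d : ℤ} {s : Finset (Fin (M + 1))} (x : famT A e d s)
    (hx : evMap A θ hθ σ e d s x = 0) : (x : J → L A M) ∈ famK A θ hθ σ e d s :=
  mem_locDeg_kerGraded_of_evalVec_eq_zero e θ hθ σ x.2
    (congrArg (fun y : evFam A θ hθ σ e d s => (y : 𝕜)) hx)

/-- The evaluation morphism `Č_d(L^J) → Č_d(𝕜; θ, σ)`. [folklore] -/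
def evHom (d : ℤ) : cech e (⊤ : Submodule (P A M) (J → P A M)) d ⟶ evCplx A θ hθ σ e d :=
  complexMapFamily (evMap A θ hθ σ e d) (locDeg_mono e _ d) (evFam_mono A θ hθ σ e d)
    fun _ _ _ _ _ => by rw [coe_evMap, coe_evMap]

/-- The inclusion morphism `Č_d(K) → Č_d(L^J)`. [folklore] -/
def inclHom (d : ℤ) :
    cech e (kerGraded A M e θ hθ σ) d ⟶ cech e (⊤ : Submodule (P A M) (J → P A M)) d :=
  complexMap (F := famK A θ hθ σ e d) (G := famT A e d) LinearMap.id (id_mem_locDeg_top e _ d)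
    (locDeg_mono e _ d) (locDeg_mono e _ d)

/-- The composite `Č_d(K) → Č_d(L^J) → Č_d(𝕜; θ, σ)` vanishes on cochains. [folklore] -/
theorem mapFamily_map_eq_zero (d n : ℤ) (g : Cochain (famK A θ hθ σ e d) n) :
    Cochain.mapFamily (evMap A θ hθ σ e d) n
      (Cochain.map LinearMap.id (id_mem_locDeg_top e _ d) n g) = 0 :=
  funext fun τ => evMap_eq_zero_of_mem A θ hθ σ e _ (g τ).2

/-- **The short complex `Č_d(K) → Č_d(L^J) → Č_d(𝕜; θ, σ)`**, `K = kerGraded e θ σ`: inclusion, then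
memberwise evaluation. [folklore] -/
def evSes (d : ℤ) : ShortComplex (CochainComplex (ModuleCat.{u} A) ℤ) :=
  ShortComplex.mk (inclHom A θ hθ σ e d) (evHom A θ hθ σ e d) (by
    ext n g
    exact mapFamily_map_eq_zero A θ hθ σ e d n g)

/-- The first object of `evSes` is `Č_d(K)`. [folklore] -/
theorem evSes_X₁ (d : ℤ) : (evSes A θ hθ σ e d).X₁ = cech e (kerGraded A M e θ hθ σ) d := rfl

/-- The second object of `evSes` is `Č_d(L^J)`. [folklore] -/
theorem evSes_X₂ (d : ℤ) :
    (evSes A θ hθ σ e d).X₂ = cech e (⊤ : Submodule (P A M) (J → P A M)) d := rfl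

/-- The third object of `evSes` is the evaluated Čech complex. [folklore] -/
theorem evSes_X₃ (d : ℤ) : (evSes A θ hθ σ e d).X₃ = evCplx A θ hθ σ e d := rfl

/-- **`0 → Č_d(K) → Č_d(L^J) → Č_d(𝕜; θ, σ) → 0` is short exact** (degreewise: the inclusion is
injective, evaluation is onto its image, and its kernel on `((L^J)_{x_s})_d` is `(K_{x_s})_d`,
`mem_locDeg_kerGraded_of_evalVec_eq_zero`). This is the algebraic form of the exactness of
`0 → 𝓘_Z(d) → 𝒪_𝐏(d) → 𝒪_Z(d) → 0` on the affine opens `D₊(x_s)`. [folklore] -/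
theorem shortExact_evSes (d : ℤ) : (evSes A θ hθ σ e d).ShortExact := by
  apply HomologicalComplex.shortExact_of_degreewise_shortExact
  intro n
  apply ModuleCat.shortComplex_shortExact
  · intro (g : Cochain (famT A e d) n)
    constructor
    · intro (hg : Cochain.mapFamily (evMap A θ hθ σ e d) n g = 0)
      have hmem : ∀ τ : Simplex (Fin (M + 1)) n, (g τ : J → L A M) ∈ famK A θ hθ σ e d τ.1 :=
        fun τ => mem_of_evMap_eq_zero A θ hθ σ e (g τ) (congr_fun hg τ)
      exact ⟨fun τ => ⟨(g τ : J → L A M), hmem τ⟩, funext fun τ => Subtype.ext rfl⟩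
    · rintro ⟨g', rfl⟩
      exact mapFamily_map_eq_zero A θ hθ σ e d n g'
  · exact Cochain.map_injective LinearMap.id (id_mem_locDeg_top e _ d) fun _ _ _ h => h
  · exact Cochain.mapFamily_surjective _ (evMap_surjective A θ hθ σ e d)

/-! ### Serre's theorems for the evaluated complexes -/

/-- **Serre's finiteness theorem for the evaluated Čech complexes**: over a Noetherian ring `A`,
`H^i(Č_d(𝕜; θ, σ))` is a finitely generated `A`-module for all `d, i ∈ ℤ` (Hartshorne III
Thm. 5.2 (a), through `moduleFinite_homology_of_shortExact_all` and the graded kernel).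
[cite: Hartshorne1977, III Thm. 5.2 (a) p. 228 (PDF p. 284)] -/
theorem moduleFinite_homology_evCplx [IsNoetherianRing A] (d i : ℤ) :
    Module.Finite A ((evCplx A θ hθ σ e d).homology i) :=
  moduleFinite_homology_of_shortExact_all e (isGraded_kerGraded e θ hθ σ) d (evSes A θ hθ σ e d)
    (shortExact_evSes A θ hθ σ e d) rfl rfl i

/-- **Serre's vanishing theorem for the evaluated Čech complexes**: over a Noetherian ring `A`
there is `d₀` with `H^i(Č_d(𝕜; θ, σ)) = 0` for all `d ≥ d₀` and `i ≥ 1` (Hartshorne III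
Thm. 5.2 (b), through `exists_forall_isZero_homology_of_shortExact`).
[cite: Hartshorne1977, III Thm. 5.2 (b) p. 228 (PDF p. 284)] -/
theorem exists_forall_isZero_homology_evCplx [IsNoetherianRing A] :
    ∃ d₀ : ℤ, ∀ d, d₀ ≤ d → ∀ i, 1 ≤ i → IsZero ((evCplx A θ hθ σ e d).homology i) :=
  exists_forall_isZero_homology_of_shortExact e (isGraded_kerGraded e θ hθ σ)
    (fun d => evSes A θ hθ σ e d) (fun d => shortExact_evSes A θ hθ σ e d) (fun _ => rfl)
    fun _ => rfl

/-- Vanishing in the form of exactness of the complex. [folklore] -/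
theorem exists_forall_exactAt_evCplx [IsNoetherianRing A] :
    ∃ d₀ : ℤ, ∀ d, d₀ ≤ d → ∀ i, 1 ≤ i → (evCplx A θ hθ σ e d).ExactAt i := by
  obtain ⟨d₀, h⟩ := exists_forall_isZero_homology_evCplx A θ hθ σ e
  exact ⟨d₀, fun d hd i hi =>
    (HomologicalComplex.exactAt_iff_isZero_homology _ _).2 (h d hd i hi)⟩

end LaurentCech

end Literature.Algebra.Homology

end
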